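import Literature.NumberTheory.EllipticCurves.HeegnerEnvelopeUnitTwistProofs
import Literature.NumberTheory.EllipticCurves.LambdaAdicSelmerDataLevelProofs
import Mathlib.RingTheory.PowerSeries.WeierstrassPreparation
import HarnessLib

/-!
# The Heegner-module envelope, LAYER-DEPENDENT unit twists: the action of ANY `g ∈ Λ` on the level-`k`
# groups preserves every `ℤ_p[Gal(K_k/K)]`-stable subgroup (Weierstrass division by `ω_k = (1+T)^{p^k} − 1`),
# so a per-layer unit twist of the `κ`-line membership suffices (proofs file)

Topic `NumberTheory/EllipticCurves`. THEOREMS ONLY (no definition, no named fact, no `sorry`); sequel of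
`HeegnerEnvelopeLevelwiseProofs`. Written by the cell `bsd-print-x9` seat `bsd-line-x9-p2` for the stub
`stub_envelopeTied` of crux stmt-BirchSwinnertonDyer-26359 `PrintX9.HowardContainmentLightFramePinnedOfPrint`.
The geometric half of the envelope (seat x9-p1) places the Kummer families of the generators `y_K, z_j` on the
`κ`-line only after a twist by an element `λ_k = Σᵢ cᵢ γ^i ∈ ℤ_p[Gal(K_k/K)]` of UNIT AUGMENTATION which may
DEPEND ON THE LAYER `k` (Hecke recurrences `S_{e+2} = a_p S_{e+1} − p S_e`, trace relations). Inverting such a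
`λ_k` is done here WITHOUT group-ring theory: `λ_k` is the level-`k` shadow of a unit `f_k ∈ Λ = ℤ_p⟦T⟧`
(`T ↦ γ − 1`), `f_k⁻¹ ∈ Λ` acts on the `Λ`-module `𝔖`, and — the one new input — the action of an ARBITRARY
power series on the level-`k` groups preserves any subgroup stable under `ℤ_p` and `conj_γ`, because modulo
`ω_k = (1+T)^{p^k} − 1`, which KILLS level `k` (`conj_{γ^{p^k}} = id` on `H¹(K_k, ·)` as `γ^{p^k} ∈ Gal(K̄/K_k)`),
every power series is a POLYNOMIAL (Weierstrass division in `ℤ_p⟦T⟧`, Mathlib `PowerSeries.weierstrassMod`;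
`ω_k ≢ 0 mod p` since its `T^{p^k}`-coefficient is `1`).

WHAT.
* §1 `proj_polynomial_smul_mem`: for `L ⊆ ∏_m H¹(K_k, E[p^m])` stable under `c ·` (`c ∈ ℤ_p`) and `conj_γ`,
  and a polynomial `r ∈ ℤ_p[T]`: `proj_k t ∈ L ⟹ proj_k (r • t) ∈ L`; `proj_omega_smul` :
  `proj_k (((1+T)^{p^k} − 1) • t) = 0` (`γ` a topological generator); `proj_smul_mem_of_stable`: the same for
  EVERY `g ∈ Λ`.
* §2 `pow_smul_heegnerModule_le_stabilizedHeegnerModule_of_layerwise_unit_twisted`: if for every spanning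
  family `s` of `ℋ_∞(F)` and every `k > δ` there is a UNIT `f ∈ Λ` (depending on `k`, `s` allowed) with
  `proj_k (f • (p^e • s)) ∈ ℤ_p[G_k]·κ_k(C)`, then `(p^e) • ℋ_∞(F) ≤ Λκ_∞(C)`; group-ring form
  `…_of_layerwise_groupRing_twisted` (twist `Σ_{i∈S} cᵢ·conj_{γ^i}`, `Σ cᵢ ∈ ℤ_pˣ`, per layer).
HONEST FRAMING: bookkeeping only; nothing about any particular curve; BSD is not proved by any of this.

References: [Washington1997] §7.1/§13.2 (Λ ≅ lim ℤ_p[Γ/Γ^{p^n}], `ω_n = (1+T)^{p^n} − 1`; Weierstrass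
division); [PerrinRiou1987BSMF] §0 p. 402; [CastellaGrossiLeeSkinner2022] Rem. 4.1.4;
[Howard2004HeegnerKolyvagin] §3.3.
-/

set_option autoImplicit false

noncomputable section

open scoped Classical Pointwise

open WeierstrassCurve Literature.NumberTheory.EllipticCurves
  Literature.NumberTheory.EllipticCurves.CastellaGrossiLeeSkinner2022 PowerSeries

universe u

namespace Literature.NumberTheory.EllipticCurves

/-! ## §1 Every `g ∈ Λ` preserves `ℤ_p[Gal(K_k/K)]`-stable subgroups at level `k` -/

section Stable

variable {K : Type u} [Field K] [NumberField K] {W : WeierstrassCurve K} {p : ℕ} [Fact p.Prime]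
  {κ : ZpExtension K p} {γ : Field.absoluteGaloisGroup K} (D : W.LambdaAdicSelmerData κ γ) (k : ℕ)
  (L : AddSubgroup (W.torsionH1Pi p (κ.layerSubgroup k)))
  (hC : ∀ (c : ℤ_[p]) {y}, y ∈ L → W.padicPi p (κ.layerSubgroup k) c y ∈ L)
  (hγL : ∀ {y}, y ∈ L → W.conjPi p (κ.layerSubgroup k) γ y ∈ L)

include hC hγL in
/-- **Polynomials in `T` preserve `ℤ_p[G_k]`-stable subgroups at level `k`**: `T` acts as `conj_γ − 1`
(`proj_X`) and constants through `ℤ_p` (`proj_C`). [cite: PerrinRiou1987BSMF, §0 p. 402 (𝔖_p as a ℤ_p⟦Gal⟧-module)] -/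
theorem proj_polynomial_smul_mem (r : Polynomial ℤ_[p]) :
    ∀ (t : D.S), D.proj k t ∈ L → D.proj k ((r : IwasawaAlgebra p) • t) ∈ L := by
  induction r using Polynomial.induction_on' with
  | add r₁ r₂ h₁ h₂ =>
    intro t ht
    rw [Polynomial.coe_add, add_smul, map_add]
    exact L.add_mem (h₁ t ht) (h₂ t ht)
  | monomial n a =>
    induction n with
    | zero =>
      intro t ht
      rw [Polynomial.monomial_zero_left, Polynomial.coe_C, D.proj_C]
      exact hC a ht
    | succ n ih =>
      intro t ht
      have hX : D.proj k ((PowerSeries.X : IwasawaAlgebra p) • t) ∈ L := by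
        rw [D.proj_X]
        exact L.sub_mem (hγL ht) ht
      rw [← Polynomial.monomial_mul_X, Polynomial.coe_mul, Polynomial.coe_X, mul_smul]
      exact ih _ hX

/-- **`ω_k = (1+T)^{p^k} − 1` kills level `k`**: `proj_k (ω_k • t) = conj_{γ^{p^k}} (proj_k t) − proj_k t = 0`,
since `γ^{p^k} ∈ Gal(K̄/K_k)` acts trivially on `H¹(K_k, ·)` (`conjH1_of_mem_holds`).
[cite: Washington1997, §13.2 (ω_n = (1+T)^{p^n} − 1, Λ/ω_n ≅ ℤ_p[Γ/Γ_n])] -/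
theorem proj_omega_smul (hγ : κ.IsTopGenerator γ) (t : D.S) :
    D.proj k ((((1 + PowerSeries.X : IwasawaAlgebra p) ^ (p ^ k)) - 1) • t) = 0 := by
  rw [sub_smul, one_smul, map_sub, proj_one_add_X_pow_smul, sub_eq_zero]
  funext m
  simp only [conjPi, AddMonoidHom.pi_apply, AddMonoidHom.coe_comp, Function.comp_apply,
    Pi.evalAddMonoidHom_apply]
  rw [conjH1_of_mem_holds (κ.layerSubgroup k) (geomTorsion W ((p : ℤ) ^ m))
    (WeierstrassCurve.LambdaAdicSelmerDataExists.pow_mem_layerSubgroup p κ hγ k), AddMonoidHom.id_apply]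

omit [NumberField K] in
/-- `ω_k` is not `0` modulo `p`: its `T^{p^k}`-coefficient is `1`. [cite: Washington1997, §7.1 (ω_n is distinguished)] -/
theorem map_omega_ne_zero :
    PowerSeries.map (IsLocalRing.residue ℤ_[p])
      ((((1 + PowerSeries.X : IwasawaAlgebra p) ^ (p ^ k)) - 1)) ≠ 0 := by
  intro h
  have hc := congrArg (PowerSeries.coeff (p ^ k)) h
  have hpk : p ^ k ≠ 0 := pow_ne_zero k (Fact.out : p.Prime).ne_zero
  -- the `T^{p^k}`-coefficient of `(1+T)^{p^k}` is `1`
  have hbin : PowerSeries.coeff (p ^ k) ((1 + PowerSeries.X : IwasawaAlgebra p) ^ (p ^ k)) = 1 := by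
    rw [add_comm, add_pow, map_sum, Finset.sum_eq_single (p ^ k)]
    · rw [one_pow, mul_one, Nat.choose_self, Nat.cast_one, mul_one, PowerSeries.coeff_X_pow_self]
    · intro m _ hm
      rw [one_pow, mul_one, ← Polynomial.coe_X, ← Polynomial.coe_pow, ← Nat.cast_comm,
        ← nsmul_eq_mul, map_nsmul, Polynomial.coe_pow, Polynomial.coe_X, PowerSeries.coeff_X_pow,
        if_neg (Ne.symm hm), smul_zero]
    · intro hnot
      exact absurd (Finset.mem_range.mpr (Nat.lt_succ_self _)) hnot
  rw [PowerSeries.coeff_map, map_sub, hbin, PowerSeries.coeff_one, if_neg hpk, sub_zero, map_one] at hc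
  rw [map_zero] at hc
  exact one_ne_zero hc

include hC hγL in
/-- **Every `g ∈ Λ` preserves `ℤ_p[G_k]`-stable subgroups at level `k`**: by Weierstrass division in
`ℤ_p⟦T⟧` (Mathlib `eq_mul_weierstrassDiv_add_weierstrassMod`), `g = ω_k · q + r` with `r` a POLYNOMIAL;
`ω_k · q` kills level `k` (`proj_omega_smul`) and `r` preserves `L` (`proj_polynomial_smul_mem`).
[cite: Washington1997, §7.1 and §13.2 (Weierstrass division; Λ ↠ ℤ_p[Γ/Γ_n] with kernel ω_n)] -/
theorem proj_smul_mem_of_stable (hγ : κ.IsTopGenerator γ) (g : IwasawaAlgebra p) (t : D.S)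
    (ht : D.proj k t ∈ L) : D.proj k (g • t) ∈ L := by
  set ω : IwasawaAlgebra p := ((1 + PowerSeries.X : IwasawaAlgebra p) ^ (p ^ k)) - 1 with hω
  have hdiv := PowerSeries.eq_mul_weierstrassDiv_add_weierstrassMod g (map_omega_ne_zero (p := p) k)
  rw [hdiv, add_smul, map_add, mul_smul, proj_omega_smul D k hγ, zero_add]
  exact proj_polynomial_smul_mem D k L hC hγL _ t ht

end Stable

/-! ## §2 Layer-dependent unit twists suffice -/

section Twist

variable {N : ℕ} [NeZero N] {W : WeierstrassCurve ℚ} [W.IsGloballyMinimal] {K : Type u} [Field K]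
  [NumberField K] {p : ℕ} [Fact p.Prime] {κ : ZpExtension K p} {γ : Field.absoluteGaloisGroup K}
  {jbar : AlgebraicClosure K →+* ℂ} (D : (W.baseChange K).LambdaAdicSelmerData κ γ)
  (F : HeegnerFamily N W K κ jbar) (C : StabilizedHeegnerData N W K κ jbar) (e : ℕ)

/-- **Layer-dependent unit twists of the levelwise membership ⟹ the envelope.** Let `γ` be a topological
generator. If for every spanning family `s` of `ℋ_∞(F)` and every `k > δ` SOME unit `f ∈ Λ` (allowed to depend
on `k` and `s`) has `proj_k (f • (p^e • s)) ∈ ℤ_p[Gal(K_k/K)]·κ_k(C)`, then `(p^e) • ℋ_∞(F) ≤ Λκ_∞(C)`: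
`proj_k (p^e • s) = proj_k (f⁻¹ • (f • p^e • s))` lies in the `ℤ_p[G_k]`-stable `ℤ_p[G_k]·κ_k`
(`proj_smul_mem_of_stable`, stability from `HeegnerEnvelopeLevelwiseProofs` §2).
[cite: CastellaGrossiLeeSkinner2022, Rem. 4.1.4] [cite: PerrinRiou1987BSMF, §3.4] -/
theorem pow_smul_heegnerModule_le_stabilizedHeegnerModule_of_layerwise_unit_twisted
    (hγ : κ.IsTopGenerator γ)
    (hlev : ∀ (s : D.S), (∀ j, D.proj j s ∈ heegnerModuleLayer γ F j) → ∀ (k : ℕ) (hk : C.depth < k),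
      ∃ f : IwasawaAlgebra p, IsUnit f ∧
        D.proj k (f • (((p : IwasawaAlgebra p) ^ e) • s)) ∈ stabilizedModuleLayer γ C k hk) :
    ((p : IwasawaAlgebra p) ^ e) • heegnerModule D F ≤ stabilizedHeegnerModule D C := by
  intro t ht
  obtain ⟨s, hs, rfl⟩ := (Submodule.mem_smul_pointwise_iff_exists _ _ _).mp ht
  clear ht
  unfold heegnerModule at hs
  induction hs using Submodule.span_induction with
  | mem g hg =>
    refine mem_stabilizedHeegnerModule_of_proj_mem D C fun k hk ↦ ?_
    obtain ⟨f, ⟨u, rfl⟩, hmem⟩ := hlev g hg k hk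
    have hrw : ((p : IwasawaAlgebra p) ^ e) • g =
        ((u⁻¹ : (IwasawaAlgebra p)ˣ) : IwasawaAlgebra p) • ((u : IwasawaAlgebra p) •
          (((p : IwasawaAlgebra p) ^ e) • g)) := by
      rw [smul_smul, Units.inv_mul, one_smul]
    rw [hrw]
    exact proj_smul_mem_of_stable D k (stabilizedModuleLayer γ C k hk)
      (fun c _ hy ↦ padicPi_mem_stabilizedModuleLayer γ C k hk c hy)
      (fun hy ↦ by
        have h1 := conjPi_pow_mem_stabilizedModuleLayer γ C k hk 1 hy
        rwa [pow_one] at h1)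
      hγ _ _ hmem
  | zero => rw [smul_zero]; exact Submodule.zero_mem _
  | add a b _ _ ha hb => rw [smul_add]; exact Submodule.add_mem _ ha hb
  | smul r a _ ha => rw [smul_comm]; exact Submodule.smul_mem _ r ha

/-- **Group-ring form, layer by layer.** If for every spanning family `s` of `ℋ_∞(F)` and every `k > δ`
there are `S ⊆ ℕ` finite and `c : ℕ → ℤ_p` with `Σ_{i∈S} cᵢ ∈ ℤ_pˣ` (unit augmentation; both may depend on
`k`, `s`) such that `Σ_{i∈S} cᵢ · conj_{γ^i} (p^e • proj_k s) ∈ ℤ_p[Gal(K_k/K)]·κ_k(C)`, then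
`(p^e) • ℋ_∞(F) ≤ Λκ_∞(C)` — the hand-over shape for the geometric half with LAYER-DEPENDENT Hecke/trace
twists. [cite: CastellaGrossiLeeSkinner2022, Rem. 4.1.4] [cite: Howard2004HeegnerKolyvagin, §3.3 (H_k as a ℤ_p[Gal(K_k/K)]-module)] -/
theorem pow_smul_heegnerModule_le_stabilizedHeegnerModule_of_layerwise_groupRing_twisted
    (hγ : κ.IsTopGenerator γ)
    (hlev : ∀ (s : D.S), (∀ j, D.proj j s ∈ heegnerModuleLayer γ F j) → ∀ (k : ℕ) (hk : C.depth < k),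
      ∃ (S : Finset ℕ) (c : ℕ → ℤ_[p]), IsUnit (∑ i ∈ S, c i) ∧
        (∑ i ∈ S, (W.baseChange K).padicPi p (κ.layerSubgroup k) (c i)
          ((W.baseChange K).conjPi p (κ.layerSubgroup k) (γ ^ i)
            (((p : ℤ) ^ e) • D.proj k s))) ∈ stabilizedModuleLayer γ C k hk) :
    ((p : IwasawaAlgebra p) ^ e) • heegnerModule D F ≤ stabilizedHeegnerModule D C := by
  refine pow_smul_heegnerModule_le_stabilizedHeegnerModule_of_layerwise_unit_twisted D F C e hγ
    fun s hs k hk ↦ ?_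
  obtain ⟨S, c, hc, hmem⟩ := hlev s hs k hk
  refine ⟨_, isUnit_sum_C_mul_one_add_X_pow S c hc, ?_⟩
  have hC : ((p : IwasawaAlgebra p) ^ e) = (PowerSeries.C ((((p : ℤ) ^ e : ℤ)) : ℤ_[p]) : IwasawaAlgebra p) := by
    rw [Int.cast_pow, Int.cast_natCast, map_pow, map_natCast]
  rw [proj_sum_C_mul_one_add_X_pow_smul, hC, (D).proj_C_intCast_smul]
  exact hmem

end Twist

end Literature.NumberTheory.EllipticCurves

end
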